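import Literature.Computability.QuantumComplexity.EvenSingularValueTransformation
import Literature.Analysis.Approximation.MarkovInequality
import HarnessLib

/-!
# Even polynomial singular value transformation from `SQ_φ(A)`: the explicit degree
# bookkeeping (CGLLTW 2022, Theorem 3.4 even case, via Lemma "low-deg-lipschitz"),
# Frobenius form

Chia, Gilyén, Li, Lin, Tang, Wang, *Sampling-based sublinear low-rank matrix arithmetic framework
for dequantizing quantum machine learning*, J. ACM 69(5):33 (2022) = arXiv:1910.06151, §3.3
"Dequantizing QSVT" (held arXiv text p. 20 L8–30 = Theorem 3.4 and its displayed even runtime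
`Õ(d^16 ‖A‖^10/(ε‖p(A)b‖)^6 · log³(1/δ) + …)`; p. 20 L58–63 = Lemma (low-degree polynomials are
smooth): "If `p` is even, then `max_{x∈[0,1]} |q(x)| ≤ 1`, `max |q'(x)| ≲ d²`, `max |q̄(x)| ≲ d²`,
`max |q̄'(x)| ≲ d⁴`"; p. 20 L65 – p. 21 L8 = proof of Thm 3.4, even case: "take `p(x) = q(x²)` for
`q` a degree-`d/2` polynomial, so `p^{(SV)}(A) = q(A†A)` … `q` is uncontrolled outside of
`[-1,1]`, so we instead apply the singular value transformation which is constant outside of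
`[-1,1]` … by (thm:evenSing), we can get `R`, `C` such that
`‖R† f̄(CC†) R + f(0)I − f(A†A)‖ ≤ ε`, where `r = Õ(d⁴‖A‖²‖A‖_F² ε⁻² log(1/δ))` and
`c = Õ(d⁸‖A‖⁶‖A‖_F² ε⁻² log(1/δ))`"; p. 21 L33–34: "The runtime is dominated by finding `C` …,
computing `f̄(CC†)` in `O(r²c)` time").

This module is the DEGREE BOOKKEEPING of that proof on top of the tree's Frobenius-form main
theorem `SampleQuery.even_singular_value_transformation_sample_complexity`
(`EvenSingularValueTransformation.lean`; Lipschitz hypotheses on all of `[0,∞)`, explicit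
constants `s ≥ 32φ²L²‖A‖_F⁴log(6/δ)/ε²`, `c ≥ 128φ⁶L̄²‖A‖_F⁸log(6/δ)/ε²`) and the tree's PROVED
Markov inequality `Literature.Analysis.Approximation.markov_inequality_Icc`
(`MarkovInequality.lean`, Korneichuk Thm 3.5.8):

* §1 `abs_eval_sub_eval_le`, `eval_divX_mul`, `abs_eval_divX_le`, `abs_eval_divX_sub_le` — the
  even half of Lemma "low-deg-lipschitz" with EXPLICIT constants on `[0,1]` for a polynomial `q`
  with `deg q ≤ k` (`p(x) = q(x²)`, `d = 2k`) and `|q| ≤ M` on `[0,1]`: `q` is `2k²M`-Lipschitz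
  (`= d²M/2`), `q̄ := divX q` (so `y·q̄(y) = q(y) − q(0)`) satisfies `|q̄| ≤ 2k²M` and is
  `4k⁴M`-Lipschitz (`= d⁴M/4`) on `[0,1]`; `chebyshev_shifted_tight` — "these bounds are tight
  for Chebyshev polynomials" (p. 20 L61): `T_k(2x − 1)` has degree `≤ k`, `|·| ≤ 1` on `[0,1]` and
  derivative `2k²` at `x = 1`, so the constant `2k²M` of `abs_eval_sub_eval_le` is attained;
* §2 the CLAMP device of the printed proof ("constant outside of `[-1,1]`"), in the form the
  tree's `d = ∞` main theorem needs: `qbarClamp q y := q̄(clamp_{[0,1]} y)` is `4k⁴M`-Lipschitz on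
  `ℝ`, `qClamp q y := y · qbarClamp q y` is `2k²M`-Lipschitz on `[0,∞)`, agrees with
  `q(y) − q(0)` on `[0,1]`, and `y · qbarClamp q y = qClamp q y` holds by definition
  (`f(0) = 0` form);
* §3 `even_polynomial_svt` — **the theorem**: for `SQ_φ(A)` with `‖A‖ ≤ 1`
  (`spec(AᵀA) ⊆ [0,1]`, automatic under the print's normalisation `‖A‖_F = 1`), `deg q ≤ k`,
  `|q| ≤ 1` on `[0,1]`, `δ ∈ (0,1]`, `ε > 0`, and
  `s ≥ 8φ²(2k)⁴‖A‖_F⁴log(6/δ)/ε²`, `s ≥ 2φ²log(3/δ)`, `c ≥ 8φ⁶(2k)⁸‖A‖_F⁸log(6/δ)/ε²`,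
  the two-stage mass of `‖Rᵀ·qbarClamp q(CCᵀ)·R + q(0)I − q(AᵀA)‖_F ≤ ε` exceeds `1 − δ`
  (`R = S_ωA`, `C = RT_τᵀ` exactly as in the main theorem) — i.e. the printed
  `r ≍ d⁴`, `c ≍ d⁸` with the constants filled in, Frobenius form (the print's operator norms
  `‖A‖²`, `‖A‖⁶` appear as `φ‖A‖_F²`-powers, as in the host theorem);
  `even_polynomial_svt_normalised` — the same under the print's standing normalisation
  `‖A‖_F ≤ 1` (p. 20 L9), where `spec(AᵀA) ⊆ [0,1]` is automatic (`spec(AᵀA) ⊆ [0, ‖A‖_F²]`)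
  and the thresholds read `s ≥ 8φ²(2k)⁴log(6/δ)/ε²`, `s ≥ 2φ²log(3/δ)`,
  `c ≥ 8φ⁶(2k)⁸log(6/δ)/ε²`;
* §4 `threshold_product_display` — the displayed exponent: at these thresholds the printed
  dominant cost `r²c` (forming `f̄(CCᵀ)`) reads `(8φ²d⁴F²ℓ/ε²)²·(8φ⁶d⁸F⁴ℓ/ε²) = 2⁹φ¹⁰d¹⁶F⁸ℓ³/ε⁶`
  (`F = ‖A‖_F²`, `ℓ = log(6/δ)`): **degree exponent 16**, as printed for the even case (an
  arithmetic identity recording the cost model of p. 21 L33–34; no algorithm is modelled here);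
  `threshold_entry_count_display` — the sketch `C ∈ ℝ^{s×c}` then has `s·c = 2⁶φ⁸d¹²F⁶ℓ²/ε⁴`
  entries (degree exponent 12 for the ENTRY count; again an identity, no query model formalised).

HONEST FRAMING.  A MATRIX-level Frobenius-norm guarantee for a classical sketching procedure under
sample-and-query access, with explicit polynomial dependence on the degree; the vector step of
Thm 3.4 (`u ≈ Rb`, `SQ_φ(v)`) and the odd case (`d^22`) are not typed here.  Nothing in this file
bears on `BQP` vs `BPP`; no sampler is implemented.  All statements are theorems; no named facts;
standard axioms.
-/

noncomputable section

open scoped Matrix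
open Polynomial Finset

namespace Literature.Computability.QuantumComplexity

namespace SampleQuery

namespace EvenPolySVT

/-! ### §1 Lemma "low-deg-lipschitz", even half, explicit constants on `[0,1]` -/

/-- **Markov ⇒ Lipschitz on `[0,1]`**: if `deg q ≤ k` and `|q| ≤ M` on `[0,1]` then
`|q(x) − q(y)| ≤ 2k²M|x − y|` for `x, y ∈ [0,1]` (mean value inequality with
`‖q'‖_{C[0,1]} ≤ 2k²M`, the tree's `markov_inequality_Icc` on an interval of length `1`).
[cite: ChiaEtAl2022, §3.3 Lemma "low-deg-lipschitz" (even case, `max|q'| ≲ d²`)] -/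
theorem abs_eval_sub_eval_le {k : ℕ} {q : ℝ[X]} (hq : q.natDegree ≤ k) {M : ℝ}
    (hM : ∀ y ∈ Set.Icc (0 : ℝ) 1, |q.eval y| ≤ M) {x y : ℝ} (hx : x ∈ Set.Icc (0 : ℝ) 1)
    (hy : y ∈ Set.Icc (0 : ℝ) 1) :
    |q.eval x - q.eval y| ≤ 2 * (k : ℝ) ^ 2 * M * |x - y| := by
  have hdeg : q.degree ≤ k := Polynomial.degree_le_of_natDegree_le hq
  have hderiv : ∀ z ∈ Set.Icc (0 : ℝ) 1, ‖deriv (fun t => q.eval t) z‖ ≤ 2 * (k : ℝ) ^ 2 * M := by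
    intro z hz
    rw [Polynomial.deriv, Real.norm_eq_abs]
    have h := Literature.Analysis.Approximation.markov_inequality_Icc hdeg zero_lt_one hM hz
    simpa using h
  have h := (convex_Icc (0 : ℝ) 1).norm_image_sub_le_of_norm_deriv_le
    (fun z _ => q.differentiableAt) hderiv hy hx
  simpa [Real.norm_eq_abs] using h

/-- **`q̄ = divX q`**: `y · q̄(y) = q(y) − q(0)` for every `y` (the polynomial
`q̄(x) := (q(x) − q(0))/x` of the printed lemma, with `q̄(0) = q'(0)` built in).
[cite: ChiaEtAl2022, §3.3 Lemma "low-deg-lipschitz" ("we define `f̄(x) := (f(x)−f(0))/x` (and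
`f̄(0) = f'(0)`)")] -/
theorem eval_divX_mul (q : ℝ[X]) (y : ℝ) : y * (divX q).eval y = q.eval y - q.eval 0 := by
  have h := congrArg (fun r : ℝ[X] => r.eval y) (divX_mul_X_add q)
  simp only [eval_add, eval_mul, eval_X, eval_C] at h
  rw [Polynomial.coeff_zero_eq_eval_zero] at h
  linarith

/-- **Sup bound for `q̄` on `[0,1]`**: `|q̄(y)| ≤ 2k²M` (`= max|q'|`-bound: for `y > 0`,
`|q(y) − q(0)| ≤ 2k²M·y`; at `y = 0`, `q̄(0) = q'(0)` and Markov).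
[cite: ChiaEtAl2022, §3.3 Lemma "low-deg-lipschitz" (even case, `max|q̄| ≲ d²`)] -/
theorem abs_eval_divX_le {k : ℕ} {q : ℝ[X]} (hq : q.natDegree ≤ k) {M : ℝ}
    (hM : ∀ y ∈ Set.Icc (0 : ℝ) 1, |q.eval y| ≤ M) {y : ℝ} (hy : y ∈ Set.Icc (0 : ℝ) 1) :
    |(divX q).eval y| ≤ 2 * (k : ℝ) ^ 2 * M := by
  rcases eq_or_lt_of_le hy.1 with h0 | hpos
  · -- `y = 0`: `q̄(0) = q.coeff 1 = q'(0)`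
    subst h0
    have hdeg : q.degree ≤ k := Polynomial.degree_le_of_natDegree_le hq
    have hmk := Literature.Analysis.Approximation.markov_inequality_Icc hdeg zero_lt_one hM hy
    have h1 : (divX q).eval 0 = (derivative q).eval 0 := by
      rw [← Polynomial.coeff_zero_eq_eval_zero, ← Polynomial.coeff_zero_eq_eval_zero,
        coeff_divX, coeff_derivative]
      simp
    rw [h1]
    simpa using hmk
  · have h := abs_eval_sub_eval_le hq hM hy ⟨le_rfl, zero_le_one⟩
    rw [sub_zero, abs_of_pos hpos] at h
    have hq' : |(divX q).eval y| * y ≤ 2 * (k : ℝ) ^ 2 * M * y := by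
      calc |(divX q).eval y| * y = |y * (divX q).eval y| := by
            rw [abs_mul, abs_of_pos hpos, mul_comm]
        _ = |q.eval y - q.eval 0| := by rw [eval_divX_mul]
        _ ≤ 2 * (k : ℝ) ^ 2 * M * y := h
    exact le_of_mul_le_mul_right hq' hpos

/-- `deg q̄ ≤ k` whenever `deg q ≤ k` (indeed `deg q̄ = deg q − 1`). [folklore] -/
private theorem natDegree_divX_le_of_le {k : ℕ} {q : ℝ[X]} (hq : q.natDegree ≤ k) :
    (divX q).natDegree ≤ k := by
  rw [natDegree_divX_eq_natDegree_tsub_one]; omega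

/-- **Lipschitz bound for `q̄` on `[0,1]`**: `|q̄(x) − q̄(y)| ≤ 4k⁴M|x − y|` (Markov for `q̄`,
`deg q̄ ≤ k`, with the sup bound `2k²M`).
[cite: ChiaEtAl2022, §3.3 Lemma "low-deg-lipschitz" (even case, `max|q̄'| ≲ d⁴`)] -/
theorem abs_eval_divX_sub_le {k : ℕ} {q : ℝ[X]} (hq : q.natDegree ≤ k) {M : ℝ}
    (hM : ∀ y ∈ Set.Icc (0 : ℝ) 1, |q.eval y| ≤ M) {x y : ℝ} (hx : x ∈ Set.Icc (0 : ℝ) 1)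
    (hy : y ∈ Set.Icc (0 : ℝ) 1) :
    |(divX q).eval x - (divX q).eval y| ≤ 4 * (k : ℝ) ^ 4 * M * |x - y| := by
  have h := abs_eval_sub_eval_le (natDegree_divX_le_of_le hq) (M := 2 * (k : ℝ) ^ 2 * M)
    (fun z hz => abs_eval_divX_le hq hM hz) hx hy
  calc _ ≤ 2 * (k : ℝ) ^ 2 * (2 * (k : ℝ) ^ 2 * M) * |x - y| := h
    _ = 4 * (k : ℝ) ^ 4 * M * |x - y| := by ring


/-- **Tightness of the `2k²` ("These bounds are tight for Chebyshev polynomials")**: for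
`q_k := T_k(2X − 1)` (so that `p(x) = q_k(x²) = T_k(2x² − 1) = T_{2k}(x)`, the even Chebyshev
polynomial of degree `d = 2k`), `deg q_k ≤ k`, `|q_k| ≤ 1` on `[0,1]`, and `q_k'(1) = 2k²` — the
Lipschitz constant `2k²M` of `abs_eval_sub_eval_le` is attained (`M = 1`).
[cite: ChiaEtAl2022, §3.3 after Lemma "low-deg-lipschitz" ("These bounds are tight for Chebyshev
polynomials")] -/
theorem chebyshev_shifted_tight (k : ℕ) :
    ((Chebyshev.T ℝ k).comp (C 2 * X - 1)).natDegree ≤ k ∧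
    (∀ y ∈ Set.Icc (0 : ℝ) 1, |((Chebyshev.T ℝ k).comp (C 2 * X - 1)).eval y| ≤ 1) ∧
    (derivative ((Chebyshev.T ℝ k).comp (C 2 * X - 1))).eval 1 = 2 * (k : ℝ) ^ 2 := by
  have hlin : (C (2 : ℝ) * X - 1).natDegree ≤ 1 := by
    refine (natDegree_sub_le _ _).trans (max_le ?_ (by simp))
    exact (natDegree_C_mul_le _ _).trans natDegree_X_le
  refine ⟨?_, ?_, ?_⟩
  · calc ((Chebyshev.T ℝ k).comp (C 2 * X - 1)).natDegree
        ≤ (Chebyshev.T ℝ k).natDegree * (C (2 : ℝ) * X - 1).natDegree := natDegree_comp_le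
      _ ≤ k * 1 := Nat.mul_le_mul (by simp [Chebyshev.natDegree_T]) hlin
      _ = k := mul_one k
  · intro y hy
    have hz : (2 * y - 1) ∈ Set.Icc (-1 : ℝ) 1 := by
      constructor <;> linarith [hy.1, hy.2]
    rw [eval_comp]
    simp only [eval_sub, eval_mul, eval_C, eval_X, eval_one]
    rw [← Real.cos_arccos hz.1 hz.2, Chebyshev.T_real_cos]
    exact Real.abs_cos_le_one _
  · rw [derivative_comp, eval_mul, eval_comp]
    simp only [derivative_sub, derivative_mul, derivative_C, derivative_X, derivative_one,
      eval_sub, eval_mul, eval_C, eval_X, eval_one, zero_mul, zero_add, mul_one, sub_zero]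
    have h := Chebyshev.derivative_T_eval_one (R := ℝ) (k : ℤ)
    simp only [Int.cast_natCast] at h
    rw [show (2 : ℝ) - 1 = 1 by norm_num, h]

/-! ### §2 The clamp device ("the singular value transformation which is constant outside") -/

/-- Clamp to `[0,1]`. [folklore] -/
def clamp01 (y : ℝ) : ℝ := max 0 (min y 1)

/-- `clamp01 y ∈ [0,1]`. [folklore] -/
private theorem clamp01_mem (y : ℝ) : clamp01 y ∈ Set.Icc (0 : ℝ) 1 :=
  ⟨le_max_left _ _, max_le zero_le_one (min_le_right _ _)⟩

/-- `clamp01` is the identity on `[0,1]`. [folklore] -/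
private theorem clamp01_of_mem {y : ℝ} (hy : y ∈ Set.Icc (0 : ℝ) 1) : clamp01 y = y := by
  rw [clamp01, min_eq_left hy.2, max_eq_right hy.1]

/-- `clamp01 y = 1` for `y ≥ 1`. [folklore] -/
private theorem clamp01_of_one_le {y : ℝ} (hy : 1 ≤ y) : clamp01 y = 1 := by
  rw [clamp01, min_eq_right hy, max_eq_right zero_le_one]

/-- `clamp01` is `1`-Lipschitz. [folklore] -/
private theorem abs_clamp01_sub_le (x y : ℝ) : |clamp01 x - clamp01 y| ≤ |x - y| := by
  unfold clamp01
  calc |max 0 (min x 1) - max 0 (min y 1)| ≤ max |(0 : ℝ) - 0| |min x 1 - min y 1| :=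
        abs_max_sub_max_le_max _ _ _ _
    _ ≤ max |(0 : ℝ) - 0| (max |x - y| |(1 : ℝ) - 1|) :=
        max_le_max le_rfl (abs_min_sub_min_le_max _ _ _ _)
    _ = |x - y| := by simp [abs_nonneg]

/-- **The clamped `q̄`**: `qbarClamp q y := q̄(clamp_{[0,1]} y)` — the `\bar f` fed to the main
theorem. [cite: ChiaEtAl2022, §3.3 proof of Theorem 3.4 (even case: "we instead apply the singular
value transformation which is constant outside of `[-1,1]`")] -/
def qbarClamp (q : ℝ[X]) (y : ℝ) : ℝ := (divX q).eval (clamp01 y)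

/-- **The clamped `q − q(0)`** in `f(0) = 0` form: `qClamp q y := y · qbarClamp q y` — equal to
`q(y) − q(0)` on `[0,1]` and linear (slope `q̄(1)`) beyond `1`. [cite: ChiaEtAl2022, §3.3 proof of
Theorem 3.4 (even case, the function `f`)] -/
def qClamp (q : ℝ[X]) (y : ℝ) : ℝ := y * qbarClamp q y

/-- `qClamp q = q − q(0)` on `[0,1]`. [cite: ChiaEtAl2022, §3.3 proof of Theorem 3.4 ("We can do
this because the singular values of `A` lie in `[0,1]`, so `q(A†A) = f(A†A)`")] -/
theorem qClamp_eq_of_mem (q : ℝ[X]) {y : ℝ} (hy : y ∈ Set.Icc (0 : ℝ) 1) :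
    qClamp q y = q.eval y - q.eval 0 := by
  rw [qClamp, qbarClamp, clamp01_of_mem hy, eval_divX_mul]

/-- The `f(0) = 0` link `y · \bar f(y) = f(y)` of the main theorem holds by definition. [folklore] -/
private theorem mul_qbarClamp (q : ℝ[X]) (y : ℝ) : y * qbarClamp q y = qClamp q y := rfl

/-- **`qbarClamp q` is `4k⁴M`-Lipschitz on `ℝ`** (`q̄` is so on `[0,1]`, `clamp01` is
`1`-Lipschitz into `[0,1]`). [cite: ChiaEtAl2022, §3.3 proof of Theorem 3.4 ("`f` and `f̄` are
Lipschitz with `L = Θ(d²)`, `L̄ = Θ(d⁴)`")] -/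
theorem abs_qbarClamp_sub_le {k : ℕ} {q : ℝ[X]} (hq : q.natDegree ≤ k) {M : ℝ}
    (hM : ∀ y ∈ Set.Icc (0 : ℝ) 1, |q.eval y| ≤ M) (x y : ℝ) :
    |qbarClamp q x - qbarClamp q y| ≤ 4 * (k : ℝ) ^ 4 * M * |x - y| := by
  have hM0 : 0 ≤ M := (abs_nonneg _).trans (hM 0 ⟨le_rfl, zero_le_one⟩)
  calc |qbarClamp q x - qbarClamp q y|
      ≤ 4 * (k : ℝ) ^ 4 * M * |clamp01 x - clamp01 y| :=
        abs_eval_divX_sub_le hq hM (clamp01_mem x) (clamp01_mem y)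
    _ ≤ 4 * (k : ℝ) ^ 4 * M * |x - y| :=
        mul_le_mul_of_nonneg_left (abs_clamp01_sub_le x y) (by positivity)

/-- **`qClamp q` is `2k²M`-Lipschitz on `[0,∞)`**: on `[0,1]` it is `q − q(0)`; on `[1,∞)` it is
linear with slope `q̄(1)`, `|q̄(1)| ≤ 2k²M`; across `1`, split at `1`.
[cite: ChiaEtAl2022, §3.3 proof of Theorem 3.4 ("`f` and `f̄` are Lipschitz with `L = Θ(d²)`")] -/
theorem abs_qClamp_sub_le {k : ℕ} {q : ℝ[X]} (hq : q.natDegree ≤ k) {M : ℝ}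
    (hM : ∀ y ∈ Set.Icc (0 : ℝ) 1, |q.eval y| ≤ M) {x y : ℝ} (hx : 0 ≤ x) (hy : 0 ≤ y) :
    |qClamp q x - qClamp q y| ≤ 2 * (k : ℝ) ^ 2 * M * |x - y| := by
  set L : ℝ := 2 * (k : ℝ) ^ 2 * M with hL
  have hM0 : 0 ≤ M := (abs_nonneg _).trans (hM 0 ⟨le_rfl, zero_le_one⟩)
  have hL0 : 0 ≤ L := by positivity
  have h1 : |(divX q).eval 1| ≤ L := abs_eval_divX_le hq hM ⟨zero_le_one, le_rfl⟩
  -- on `[1, ∞)`: linear with slope `q̄(1)`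
  have hlin : ∀ z : ℝ, 1 ≤ z → qClamp q z = z * (divX q).eval 1 := fun z hz => by
    rw [qClamp, qbarClamp, clamp01_of_one_le hz]
  -- both in `[0,1]`
  have hin : ∀ u v : ℝ, u ∈ Set.Icc (0 : ℝ) 1 → v ∈ Set.Icc (0 : ℝ) 1 →
      |qClamp q u - qClamp q v| ≤ L * |u - v| := fun u v hu hv => by
    rw [qClamp_eq_of_mem q hu, qClamp_eq_of_mem q hv, sub_sub_sub_cancel_right]
    exact abs_eval_sub_eval_le hq hM hu hv
  -- both in `[1,∞)`
  have hout : ∀ u v : ℝ, 1 ≤ u → 1 ≤ v → |qClamp q u - qClamp q v| ≤ L * |u - v| :=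
    fun u v hu hv => by
    rw [hlin u hu, hlin v hv, ← sub_mul, abs_mul, mul_comm]
    exact mul_le_mul_of_nonneg_right h1 (abs_nonneg _)
  -- across `1`
  have hcross : ∀ u v : ℝ, u ∈ Set.Icc (0 : ℝ) 1 → 1 ≤ v →
      |qClamp q u - qClamp q v| ≤ L * |u - v| := fun u v hu hv => by
    have ha := hin u 1 hu ⟨zero_le_one, le_rfl⟩
    have hb := hout 1 v le_rfl hv
    rw [abs_of_nonpos (by linarith [hu.2] : u - 1 ≤ 0)] at ha
    rw [abs_of_nonpos (by linarith : (1 : ℝ) - v ≤ 0)] at hb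
    rw [abs_of_nonpos (by linarith [hu.2] : u - v ≤ 0)]
    calc |qClamp q u - qClamp q v|
        ≤ |qClamp q u - qClamp q 1| + |qClamp q 1 - qClamp q v| := abs_sub_le _ _ _
      _ ≤ L * -(u - 1) + L * -(1 - v) := add_le_add ha hb
      _ = L * -(u - v) := by ring
  rcases le_or_gt x 1 with hx1 | hx1 <;> rcases le_or_gt y 1 with hy1 | hy1
  · exact hin x y ⟨hx, hx1⟩ ⟨hy, hy1⟩
  · exact hcross x y ⟨hx, hx1⟩ hy1.le
  · rw [abs_sub_comm, abs_sub_comm x y]; exact hcross y x ⟨hy, hy1⟩ hx1.le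
  · exact hout x y hx1.le hy1.le

/-! ### §3 The theorem: even polynomial SVT with explicit degree dependence -/

variable {m n s c : ℕ} {φ : ℝ} {A : Matrix (Fin m) (Fin n) ℝ}

/-- The spectrum of a real Gram matrix `AᵀA` lies in `[0, ∞)`. [folklore] -/
private theorem spectrum_gram_nonneg (A : Matrix (Fin m) (Fin n) ℝ) {x : ℝ}
    (hx : x ∈ spectrum ℝ (Aᵀ * A)) : 0 ≤ x := by
  have hP : (Aᵀ * A).PosSemidef := by
    simpa [Matrix.conjTranspose_eq_transpose_of_trivial] using Matrix.posSemidef_conjTranspose_mul_self A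
  rw [hP.1.spectrum_real_eq_range_eigenvalues] at hx
  obtain ⟨i, rfl⟩ := hx
  exact hP.eigenvalues_nonneg i


/-- **`spec(AᵀA) ⊆ [0, ‖A‖_F²]`**: every eigenvalue of the Gram matrix is at most the trace
`tr(AᵀA) = ‖A‖_F²` (all eigenvalues are `≥ 0`).  Hence the print's normalisation `‖A‖_F = 1`
gives `‖A‖ ≤ 1` for free. [folklore] -/
private theorem spectrum_gram_le_frobSq (A : Matrix (Fin m) (Fin n) ℝ) {x : ℝ}
    (hx : x ∈ spectrum ℝ (Aᵀ * A)) : x ≤ frobSq A := by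
  classical
  have hP : (Aᵀ * A).PosSemidef := by
    simpa [Matrix.conjTranspose_eq_transpose_of_trivial] using Matrix.posSemidef_conjTranspose_mul_self A
  have hH : (Aᵀ * A).IsHermitian := hP.1
  rw [hH.spectrum_real_eq_range_eigenvalues] at hx
  obtain ⟨i, rfl⟩ := hx
  have hnn : ∀ j, 0 ≤ hH.eigenvalues j := hP.eigenvalues_nonneg
  have htr : (Aᵀ * A).trace = ∑ j, hH.eigenvalues j := by
    have h := hH.trace_eq_sum_eigenvalues
    simpa using h
  have htr' : (Aᵀ * A).trace = frobSq A := by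
    simp only [Matrix.trace, Matrix.diag_apply, Matrix.mul_apply, Matrix.transpose_apply,
      frobSq_eq_sum_sq, pow_two]
    exact Finset.sum_comm
  calc hH.eigenvalues i ≤ ∑ j, hH.eigenvalues j :=
        Finset.single_le_sum (fun j _ => hnn j) (Finset.mem_univ i)
    _ = frobSq A := by rw [← htr, htr']

/-- **On the target the clamp is invisible**: if `spec(AᵀA) ⊆ [0,1]` (`‖A‖ ≤ 1`) then
`qClamp q (AᵀA) = q(AᵀA) − q(0)·I` (continuous functional calculus = polynomial evaluation).
[cite: ChiaEtAl2022, §3.3 proof of Theorem 3.4 ("the singular values of `A` lie in `[0,1]`, so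
`q(A†A) = f(A†A)`")] -/
theorem cfc_qClamp_gram_eq (q : ℝ[X]) (hA1 : ∀ x ∈ spectrum ℝ (Aᵀ * A), x ≤ 1) :
    cfc (qClamp q) (Aᵀ * A) = aeval (Aᵀ * A) q - (q.eval 0) • (1 : Matrix (Fin n) (Fin n) ℝ) := by
  have hH : IsSelfAdjoint (Aᵀ * A) := by
    have h : (Aᵀ * A).IsHermitian := by
      simpa [Matrix.conjTranspose_eq_transpose_of_trivial] using
        Matrix.isHermitian_conjTranspose_mul_self A
    exact h
  have h1 : cfc (qClamp q) (Aᵀ * A) = cfc (fun y => (q - C (q.eval 0)).eval y) (Aᵀ * A) := by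
    refine cfc_congr fun x hx => ?_
    rw [qClamp_eq_of_mem q ⟨spectrum_gram_nonneg A hx, hA1 x hx⟩, eval_sub, eval_C]
  rw [h1, cfc_polynomial _ _ hH, map_sub, aeval_C, Algebra.algebraMap_eq_smul_one]

/-- **Theorem (even polynomial singular value transformation, explicit degree dependence;
CGLLTW Thm 3.4 even case at the matrix level, Frobenius form).**  Let `SQ_φ(A)` be given
(`A ≠ 0`, `‖A‖ ≤ 1` i.e. `spec(AᵀA) ⊆ [0,1]`), `q ∈ ℝ[X]` with `deg q ≤ k` and `|q| ≤ 1` on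
`[0,1]` (so `p(x) := q(x²)` is an even polynomial of degree `d = 2k` bounded by `1` on `[-1,1]`
and `p^{(SV)}(A) = q(AᵀA)`), `δ ∈ (0,1]`, `ε > 0`, and sample sizes
`s ≥ 8φ²d⁴‖A‖_F⁴log(6/δ)/ε²`, `s ≥ 2φ²log(3/δ)`, `c ≥ 8φ⁶d⁸‖A‖_F⁸log(6/δ)/ε²` (`d = 2k`).
Sampling `ω ∈ [m]^s` from `𝒟_ã` (`R = S_ωA`) and then `τ ∈ [n]^c` from the row-norm distribution of
`(S_ωÃ)ᵀ` (`C = RT_τᵀ`), the two-stage mass of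
`‖Rᵀ · q̄_clamp(CCᵀ) · R + q(0)I − q(AᵀA)‖_F ≤ ε` exceeds `1 − δ`, where
`q̄_clamp = qbarClamp q` is `q̄(x) = (q(x)−q(0))/x` with its argument clamped to `[0,1]`.  This is
`even_singular_value_transformation_sample_complexity` at `f = qClamp q` (`L = d²/2`),
`\bar f = qbarClamp q` (`L̄ = d⁴/4`) — the constants of Lemma "low-deg-lipschitz" made explicit by
Markov's inequality — i.e. the printed `r = Õ(d⁴‖A‖²‖A‖_F²ε⁻²log(1/δ))`,
`c = Õ(d⁸‖A‖⁶‖A‖_F²ε⁻²log(1/δ))` with constants, in the host theorem's Frobenius currency.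
[cite: ChiaEtAl2022, §3.3 Theorem 3.4 (even case) with Lemma "low-deg-lipschitz" and the proof's
displayed `r`, `c` (held arXiv text p. 20 L8–30, L58–63, p. 20 L65 – p. 21 L8)] -/
theorem even_polynomial_svt (W : MatrixOversamplingWitness φ A) (hA : A ≠ 0)
    (hA1 : ∀ x ∈ spectrum ℝ (Aᵀ * A), x ≤ 1) (hs : 0 < s) (hc : 0 < c) {δ ε : ℝ}
    (hδ : 0 < δ) (hδ1 : δ ≤ 1) (hε : 0 < ε) {k : ℕ} (q : ℝ[X]) (hq : q.natDegree ≤ k)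
    (hq1 : ∀ y ∈ Set.Icc (0 : ℝ) 1, |q.eval y| ≤ 1)
    (hsL : 8 * φ ^ 2 * (2 * k) ^ 4 * frobSq A ^ 2 * Real.log (6 / δ) / ε ^ 2 ≤ s)
    (hs3 : 2 * φ ^ 2 * Real.log (3 / δ) ≤ s)
    (hcL : 8 * φ ^ 6 * (2 * k) ^ 8 * frobSq A ^ 4 * Real.log (6 / δ) / ε ^ 2 ≤ c) :
    1 - δ <
      ∑ ω : Fin s → Fin m, iidWeight (rowDist W.tilde) ω *
        ∑ τ ∈ univ.filter (fun τ : Fin c → Fin n =>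
          Real.sqrt (frobSq ((sketch (rowDist W.tilde) ω * A)ᵀ *
              cfc (qbarClamp q) ((sketch (rowDist (sketch (rowDist W.tilde) ω * W.tilde)ᵀ) τ *
                  (sketch (rowDist W.tilde) ω * A)ᵀ)ᵀ *
                (sketch (rowDist (sketch (rowDist W.tilde) ω * W.tilde)ᵀ) τ *
                  (sketch (rowDist W.tilde) ω * A)ᵀ)) *
              (sketch (rowDist W.tilde) ω * A) + (q.eval 0) • (1 : Matrix (Fin n) (Fin n) ℝ) -
              aeval (Aᵀ * A) q)) ≤ ε),
          iidWeight (rowDist (sketch (rowDist W.tilde) ω * W.tilde)ᵀ) τ := by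
  classical
  have hL0 : (0 : ℝ) ≤ 2 * (k : ℝ) ^ 2 * 1 := by positivity
  have hLb0 : (0 : ℝ) ≤ 4 * (k : ℝ) ^ 4 * 1 := by positivity
  have hL : ∀ x y : ℝ, 0 ≤ x → 0 ≤ y →
      |qClamp q x - qClamp q y| ≤ 2 * (k : ℝ) ^ 2 * 1 * |x - y| :=
    fun x y hx hy => abs_qClamp_sub_le hq hq1 hx hy
  have hLb : ∀ x y : ℝ, 0 ≤ x → 0 ≤ y →
      |qbarClamp q x - qbarClamp q y| ≤ 4 * (k : ℝ) ^ 4 * 1 * |x - y| :=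
    fun x y _ _ => abs_qbarClamp_sub_le hq hq1 x y
  have hff : ∀ x : ℝ, 0 ≤ x → x * qbarClamp q x = qClamp q x := fun x _ => rfl
  have hsL' : 32 * φ ^ 2 * (2 * (k : ℝ) ^ 2 * 1) ^ 2 * frobSq A ^ 2 * Real.log (6 / δ) / ε ^ 2 ≤ s := by
    have : 32 * φ ^ 2 * (2 * (k : ℝ) ^ 2 * 1) ^ 2 * frobSq A ^ 2 * Real.log (6 / δ) / ε ^ 2 =
        8 * φ ^ 2 * (2 * k) ^ 4 * frobSq A ^ 2 * Real.log (6 / δ) / ε ^ 2 := by ring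
    rw [this]; exact hsL
  have hcL' : 128 * φ ^ 6 * (4 * (k : ℝ) ^ 4 * 1) ^ 2 * frobSq A ^ 4 * Real.log (6 / δ) / ε ^ 2 ≤ c := by
    have : 128 * φ ^ 6 * (4 * (k : ℝ) ^ 4 * 1) ^ 2 * frobSq A ^ 4 * Real.log (6 / δ) / ε ^ 2 =
        8 * φ ^ 6 * (2 * k) ^ 8 * frobSq A ^ 4 * Real.log (6 / δ) / ε ^ 2 := by ring
    rw [this]; exact hcL
  have key := even_singular_value_transformation_sample_complexity W hA hs hc hδ hδ1 hε
    (qClamp q) (qbarClamp q) hL0 hL hLb0 hLb hff hsL' hs3 hcL'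
  have hId := cfc_qClamp_gram_eq q hA1 (A := A)
  simp_rw [hId, sub_sub_eq_add_sub] at key
  exact key


/-- **Corollary (the print's normalisation `‖A‖_F ≤ 1`).**  Under `‖A‖_F² ≤ 1` — Theorem 3.4's
standing hypothesis `‖A‖_F = 1` — the spectral hypothesis is automatic
(`spectrum_gram_le_frobSq`) and the thresholds read `s ≥ 8φ²d⁴log(6/δ)/ε²`, `s ≥ 2φ²log(3/δ)`,
`c ≥ 8φ⁶d⁸log(6/δ)/ε²` (`d = 2k`): the printed `r ≍ d⁴`, `c ≍ d⁸`, hence `r²c ≍ d¹⁶`, with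
constants. [cite: ChiaEtAl2022, §3.3 Theorem 3.4 (even case: "`‖A‖_F = 1`", runtime
`Õ(d¹⁶…)`)] -/
theorem even_polynomial_svt_normalised (W : MatrixOversamplingWitness φ A) (hA : A ≠ 0)
    (hF : frobSq A ≤ 1) (hs : 0 < s) (hc : 0 < c) {δ ε : ℝ}
    (hδ : 0 < δ) (hδ1 : δ ≤ 1) (hε : 0 < ε) {k : ℕ} (q : ℝ[X]) (hq : q.natDegree ≤ k)
    (hq1 : ∀ y ∈ Set.Icc (0 : ℝ) 1, |q.eval y| ≤ 1)
    (hsL : 8 * φ ^ 2 * (2 * k) ^ 4 * Real.log (6 / δ) / ε ^ 2 ≤ s)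
    (hs3 : 2 * φ ^ 2 * Real.log (3 / δ) ≤ s)
    (hcL : 8 * φ ^ 6 * (2 * k) ^ 8 * Real.log (6 / δ) / ε ^ 2 ≤ c) :
    1 - δ <
      ∑ ω : Fin s → Fin m, iidWeight (rowDist W.tilde) ω *
        ∑ τ ∈ univ.filter (fun τ : Fin c → Fin n =>
          Real.sqrt (frobSq ((sketch (rowDist W.tilde) ω * A)ᵀ *
              cfc (qbarClamp q) ((sketch (rowDist (sketch (rowDist W.tilde) ω * W.tilde)ᵀ) τ *
                  (sketch (rowDist W.tilde) ω * A)ᵀ)ᵀ *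
                (sketch (rowDist (sketch (rowDist W.tilde) ω * W.tilde)ᵀ) τ *
                  (sketch (rowDist W.tilde) ω * A)ᵀ)) *
              (sketch (rowDist W.tilde) ω * A) + (q.eval 0) • (1 : Matrix (Fin n) (Fin n) ℝ) -
              aeval (Aᵀ * A) q)) ≤ ε),
          iidWeight (rowDist (sketch (rowDist W.tilde) ω * W.tilde)ᵀ) τ := by
  have hF0 : 0 ≤ frobSq A := frobSq_nonneg A
  have hℓ : 0 ≤ Real.log (6 / δ) := Real.log_nonneg (by rw [le_div_iff₀ hδ]; linarith)
  have hφ : 0 < φ := W.pos hA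
  have hF2 : frobSq A ^ 2 ≤ 1 := pow_le_one₀ hF0 hF
  have hF4 : frobSq A ^ 4 ≤ 1 := pow_le_one₀ hF0 hF
  refine even_polynomial_svt W hA (fun x hx => (spectrum_gram_le_frobSq A hx).trans hF) hs hc hδ
    hδ1 hε q hq hq1 (le_trans ?_ hsL) hs3 (le_trans ?_ hcL)
  · have h0 : 0 ≤ 8 * φ ^ 2 * (2 * (k : ℝ)) ^ 4 * Real.log (6 / δ) / ε ^ 2 := by positivity
    calc 8 * φ ^ 2 * (2 * (k : ℝ)) ^ 4 * frobSq A ^ 2 * Real.log (6 / δ) / ε ^ 2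
        = 8 * φ ^ 2 * (2 * (k : ℝ)) ^ 4 * Real.log (6 / δ) / ε ^ 2 * frobSq A ^ 2 := by ring
      _ ≤ 8 * φ ^ 2 * (2 * (k : ℝ)) ^ 4 * Real.log (6 / δ) / ε ^ 2 := mul_le_of_le_one_right h0 hF2
  · have h0 : 0 ≤ 8 * φ ^ 6 * (2 * (k : ℝ)) ^ 8 * Real.log (6 / δ) / ε ^ 2 := by positivity
    calc 8 * φ ^ 6 * (2 * (k : ℝ)) ^ 8 * frobSq A ^ 4 * Real.log (6 / δ) / ε ^ 2
        = 8 * φ ^ 6 * (2 * (k : ℝ)) ^ 8 * Real.log (6 / δ) / ε ^ 2 * frobSq A ^ 4 := by ring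
      _ ≤ 8 * φ ^ 6 * (2 * (k : ℝ)) ^ 8 * Real.log (6 / δ) / ε ^ 2 := mul_le_of_le_one_right h0 hF4

/-! ### §4 The displayed exponent -/

/-- **Display (degree exponent 16).**  At the thresholds of `even_polynomial_svt`,
`s = 8φ²d⁴F²ℓ/ε²` and `c = 8φ⁶d⁸F⁴ℓ/ε²` (`F = ‖A‖_F²`, `ℓ = log(6/δ)`), the printed dominant
cost `r²c` of the even case ("computing `f̄(CC†)` in `O(r²c)` time") reads
`s²c = 2⁹ φ¹⁰ d¹⁶ F⁸ ℓ³ / ε⁶` — degree exponent `16`, matching the print's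
`Õ(d¹⁶‖A‖¹⁰/(ε‖p(A)b‖)⁶·log³(1/δ))` (there `‖A‖_F = 1`; here the operator norms are relaxed to
`φ‖A‖_F²`-powers).  An arithmetic identity recording the printed cost model; no algorithm is
modelled. [cite: ChiaEtAl2022, §3.3 Theorem 3.4 (even runtime display) and its proof ("The runtime
is dominated by … computing `f̄(CC†)` in `O(r²c)` time", held arXiv text p. 21 L33–34)] -/
theorem threshold_product_display (φ d F ℓ ε : ℝ) (hε : ε ≠ 0) :
    (8 * φ ^ 2 * d ^ 4 * F ^ 2 * ℓ / ε ^ 2) ^ 2 * (8 * φ ^ 6 * d ^ 8 * F ^ 4 * ℓ / ε ^ 2) =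
      2 ^ 9 * φ ^ 10 * d ^ 16 * F ^ 8 * ℓ ^ 3 / ε ^ 6 := by
  field_simp
  ring

/-- **Display (entry count of the sketch, degree exponent 12).**  At the same thresholds the sketch
`C ∈ ℝ^{s×c}` — the only part of `A` the procedure reads entrywise ("finding `C`") — has
`s·c = 2⁶ φ⁸ d¹² F⁶ ℓ² / ε⁴` entries (`F = ‖A‖_F²`, `ℓ = log(6/δ)`).  Recorded so that the
threshold cell can juxtapose an ENTRY count (not a running time) with query-model floors; an
arithmetic identity, no algorithm or query model is formalised here. [cite: ChiaEtAl2022, §3.3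
proof of Theorem 3.4 (even case: "`R ∈ ℝ^{r×n}` and `C ∈ ℝ^{r×c}`", "The runtime is dominated by
finding `C` …", held arXiv text p. 21 L6–8, L33)] -/
theorem threshold_entry_count_display (φ d F ℓ ε : ℝ) (hε : ε ≠ 0) :
    (8 * φ ^ 2 * d ^ 4 * F ^ 2 * ℓ / ε ^ 2) * (8 * φ ^ 6 * d ^ 8 * F ^ 4 * ℓ / ε ^ 2) =
      2 ^ 6 * φ ^ 8 * d ^ 12 * F ^ 6 * ℓ ^ 2 / ε ^ 4 := by
  field_simp
  ring

end EvenPolySVT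

end SampleQuery

end Literature.Computability.QuantumComplexity
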